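import Literature.NumberTheory.LFunctions.EnergyThirdMoment
import HarnessLib

/-!
# `Ŵ` is locally constant at scale `1/T` (Guth–Maynard Lemma 11.7)

Topic `NumberTheory/LFunctions`, family RH. Part of the programme around the tree's named fact
`Literature.NumberTheory.LFunctions.zeroDensity_guth_maynard`, reduced by `LargeValuesAssembly.lean` to
Propositions 6.1, 10.1, 11.1 of L. Guth, J. Maynard, *New large value estimates for Dirichlet
polynomials*, Ann. of Math. 203 (2026). For the trigonometric polynomial `Ŵ(τ) = ∑_{t∈W} e(−tτ)` of a
finite `W ⊂ [T₀, T₀+T]` (`GuthMaynardRFunction.trigPoly`; recall `R(v) = Ŵ(−log|v|/2π)`) this file PROVES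
Lemma 11.7 of the paper ("`|R(v)| ≪ T∫_{|v'−v|⪅1/T}|R(v')|dv' + O(T^{-100})`") in an exact weighted form,
keeping the rapidly decaying weight `|ψ̂|` inside the integral instead of truncating:

* `trigPoly_eq_integral`: `Ŵ(τ) = ∫ ψ̂(ξ) e(−T₀ξ/T) Ŵ(τ − ξ/T) dξ` for a smooth compactly supported `ψ`
  with `ψ = 1` on `[0,1]` (the paper's display, by Fourier inversion for `ψ`);
* `norm_trigPoly_le_integral`: `|Ŵ(τ)| ≤ ∫ |ψ̂(ξ)| |Ŵ(τ − ξ/T)| dξ`;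
* `norm_trigPoly_cube_le_integral`: `|Ŵ(τ)|³ ≤ 2A² ∫ |ψ̂(ξ)| |Ŵ(τ − ξ/T)|³ dξ`, `A = max(1, ‖ψ̂‖₁)` (the
  cubic form needed in the proof of Lemma 11.8, via `u²v ≤ (2u³ + v³)/3`);
* `exists_unitBump`: such a `ψ` exists.

No definition and no named fact is introduced; everything here is proved.

## References

* L. Guth, J. Maynard, *New large value estimates for Dirichlet polynomials*, Ann. of Math. (2)
  203 (2026), no. 2; arXiv:2405.20552 (2024): §11, Lemma 11.7 and its proof; proof of Lemma 11.8.
-/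

noncomputable section

open Real Set Filter Topology Complex MeasureTheory Finset
open scoped FourierTransform ContDiff

namespace Literature.NumberTheory.LFunctions

namespace GuthMaynardLocallyConstant

open GuthMaynardFourier GuthMaynardRFunction GuthMaynardEnergy

/-! ## Guth–Maynard Lemma 11.7: `Ŵ` (hence `R`) is locally constant at scale `1/T` -/

/-- The elementary inequality `u²v ≤ (2u³ + v³)/3` for `u, v ≥ 0` (since
`2u³ + v³ − 3u²v = (u − v)²(2u + v)`). [folklore] -/
theorem sq_mul_le_cubes {u v : ℝ} (hu : 0 ≤ u) (hv : 0 ≤ v) : u ^ 2 * v ≤ (2 * u ^ 3 + v ^ 3) / 3 := by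
  have h : 2 * u ^ 3 + v ^ 3 - 3 * (u ^ 2 * v) = (u - v) ^ 2 * (2 * u + v) := by ring
  have h2 : 0 ≤ (u - v) ^ 2 * (2 * u + v) := by positivity
  linarith

section bump

variable {ψ : ℝ → ℝ}

/-- **Guth–Maynard Lemma 11.7, exact form.** Let `W ⊂ [T₀, T₀ + T]` be finite (`T > 0`) and `ψ` a
smooth compactly supported bump with `ψ = 1` on `[0, 1]`. Then
`Ŵ(τ) = ∫ ψ̂(ξ) e(−T₀ξ/T) Ŵ(τ − ξ/T) dξ` ("`Ŵ(τ) = ∑_{t∈W} e(−tτ)ψ((t−T₀)/T) = ∫ ψ̂(ξ)Ŵ(τ−ξ/T)e(−T₀ξ/T)dξ`").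
[cite: GuthMaynard2026, Lemma 11.7 (proof)] -/
theorem trigPoly_eq_integral (hψ : ContDiff ℝ ∞ ψ) (hψs : HasCompactSupport ψ)
    (hψ1 : ∀ x : ℝ, 0 ≤ x → x ≤ 1 → ψ x = 1) {T₀ T : ℝ} (hT : 0 < T) (W : Finset ℝ)
    (hW : ∀ t ∈ W, T₀ ≤ t ∧ t ≤ T₀ + T) (τ : ℝ) :
    trigPoly W τ = ∫ ξ, (𝓕 (fun y ↦ (ψ y : ℂ)) ξ * ((𝐞 (-(T₀ * ξ / T))) : ℂ)) *
      trigPoly W (τ - ξ / T) := by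
  set F : ℝ → ℂ := 𝓕 (fun y ↦ (ψ y : ℂ)) with hF
  have hFi : Integrable F := integrable_fourier_bump hψ hψs
  -- each term
  have hterm : ∀ t ∈ W, Complex.exp ((((-(2 * π * t * τ)) : ℝ) : ℂ) * I) =
      ∫ ξ, (F ξ * ((𝐞 (-(T₀ * ξ / T))) : ℂ)) *
        Complex.exp ((((-(2 * π * t * (τ - ξ / T))) : ℝ) : ℂ) * I) := by
    intro t ht
    set y : ℝ := (t - T₀) / T with hy
    have hy0 : 0 ≤ y := div_nonneg (by linarith [(hW t ht).1]) hT.le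
    have hy1 : y ≤ 1 := by rw [hy, div_le_one hT]; linarith [(hW t ht).2]
    have h1 : (1 : ℂ) = ∫ ξ, ((𝐞 (ξ * y) : ℂ)) * F ξ := by
      rw [← bump_eq_integral hψ hψs y, hψ1 y hy0 hy1]; simp
    have hT0 : (T : ℂ) ≠ 0 := Complex.ofReal_ne_zero.mpr hT.ne'
    have h2 : ∀ ξ : ℝ, Complex.exp ((((-(2 * π * t * τ)) : ℝ) : ℂ) * I) * ((𝐞 (ξ * y) : ℂ)) =
        ((𝐞 (-(T₀ * ξ / T))) : ℂ) * Complex.exp ((((-(2 * π * t * (τ - ξ / T))) : ℝ) : ℂ) * I) := by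
      intro ξ
      rw [Real.fourierChar_apply, Real.fourierChar_apply, ← Complex.exp_add, ← Complex.exp_add]
      congr 1
      simp only [hy]
      push_cast
      field_simp
      ring
    calc Complex.exp ((((-(2 * π * t * τ)) : ℝ) : ℂ) * I)
        = Complex.exp ((((-(2 * π * t * τ)) : ℝ) : ℂ) * I) * 1 := by ring
      _ = Complex.exp ((((-(2 * π * t * τ)) : ℝ) : ℂ) * I) * ∫ ξ, ((𝐞 (ξ * y) : ℂ)) * F ξ := by
          rw [← h1]
      _ = ∫ ξ, Complex.exp ((((-(2 * π * t * τ)) : ℝ) : ℂ) * I) * (((𝐞 (ξ * y) : ℂ)) * F ξ) := by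
          rw [← integral_const_mul]
      _ = _ := by
          refine integral_congr_ae (Eventually.of_forall fun ξ ↦ ?_)
          simp only
          rw [← mul_assoc, h2 ξ]
          ring
  -- sum up
  unfold trigPoly
  rw [Finset.sum_congr rfl hterm, ← integral_finsetSum]
  · refine integral_congr_ae (Eventually.of_forall fun ξ ↦ ?_)
    simp only [Finset.mul_sum]
  · intro t _
    have : (fun ξ : ℝ ↦ (F ξ * ((𝐞 (-(T₀ * ξ / T))) : ℂ)) *
        Complex.exp ((((-(2 * π * t * (τ - ξ / T))) : ℝ) : ℂ) * I)) =
        fun ξ : ℝ ↦ F ξ * ((((𝐞 (-(T₀ * ξ / T))) : ℂ)) *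
          Complex.exp ((((-(2 * π * t * (τ - ξ / T))) : ℝ) : ℂ) * I)) := by
      ext ξ; ring
    rw [this]
    refine hFi.mul_bdd (c := 1) (Continuous.aestronglyMeasurable ?_)
      (Eventually.of_forall fun ξ ↦ ?_)
    · simp only [Real.fourierChar_apply]
      fun_prop
    · rw [norm_mul, Circle.norm_coe, one_mul, Complex.norm_exp_ofReal_mul_I]

/-- **Lemma 11.7, the bound** `|Ŵ(τ)| ≤ ∫ |ψ̂(ξ)| |Ŵ(τ − ξ/T)| dξ` (i.e.
`|Ŵ(τ)| ≪ T∫|ψ̂(T(τ−τ'))||Ŵ(τ')|dτ'`: "`|R(v)| ≪ T ∫_{|v'−v|⪅1/T}|R(v')|dv' + O(T^{-100})`", with the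
rapidly decaying weight kept). [cite: GuthMaynard2026, Lemma 11.7] -/
theorem norm_trigPoly_le_integral (hψ : ContDiff ℝ ∞ ψ) (hψs : HasCompactSupport ψ)
    (hψ1 : ∀ x : ℝ, 0 ≤ x → x ≤ 1 → ψ x = 1) {T₀ T : ℝ} (hT : 0 < T) (W : Finset ℝ)
    (hW : ∀ t ∈ W, T₀ ≤ t ∧ t ≤ T₀ + T) (τ : ℝ) :
    ‖trigPoly W τ‖ ≤ ∫ ξ, ‖𝓕 (fun y ↦ (ψ y : ℂ)) ξ‖ * ‖trigPoly W (τ - ξ / T)‖ := by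
  rw [trigPoly_eq_integral hψ hψs hψ1 hT W hW τ]
  refine (norm_integral_le_integral_norm _).trans (le_of_eq ?_)
  refine integral_congr_ae (Eventually.of_forall fun ξ ↦ ?_)
  simp only [norm_mul, Circle.norm_coe, mul_one]

/-- **Lemma 11.7, cubic form**: with `A = max(1, ‖ψ̂‖₁)`,
`|Ŵ(τ)|³ ≤ 2A² ∫ |ψ̂(ξ)| |Ŵ(τ − ξ/T)|³ dξ` (from the linear bound and `u²v ≤ (2u³+v³)/3`), the form
used in the proof of Lemma 11.8. [cite: GuthMaynard2026, Lemmas 11.7–11.8] -/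
theorem norm_trigPoly_cube_le_integral (hψ : ContDiff ℝ ∞ ψ) (hψs : HasCompactSupport ψ)
    (hψ1 : ∀ x : ℝ, 0 ≤ x → x ≤ 1 → ψ x = 1) {T₀ T : ℝ} (hT : 0 < T) (W : Finset ℝ)
    (hW : ∀ t ∈ W, T₀ ≤ t ∧ t ≤ T₀ + T) (τ : ℝ) :
    ‖trigPoly W τ‖ ^ 3 ≤ 2 * (max 1 (∫ ξ, ‖𝓕 (fun y ↦ (ψ y : ℂ)) ξ‖)) ^ 2 *
      ∫ ξ, ‖𝓕 (fun y ↦ (ψ y : ℂ)) ξ‖ * ‖trigPoly W (τ - ξ / T)‖ ^ 3 := by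
  set F : ℝ → ℂ := 𝓕 (fun y ↦ (ψ y : ℂ)) with hF
  have hFi : Integrable F := integrable_fourier_bump hψ hψs
  set A : ℝ := max 1 (∫ ξ, ‖F ξ‖) with hA
  have hA1 : 1 ≤ A := le_max_left _ _
  have hA0 : 0 < A := by linarith
  have hK : ∫ ξ, ‖F ξ‖ ≤ A := le_max_right _ _
  set a : ℝ := ‖trigPoly W τ‖ with ha
  have ha0 : 0 ≤ a := norm_nonneg _
  -- `Ŵ` is bounded and continuous
  have hWle : ∀ τ' : ℝ, ‖trigPoly W τ'‖ ≤ W.card := norm_trigPoly_le W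
  have hWcont : Continuous (fun ξ : ℝ ↦ trigPoly W (τ - ξ / T)) := by
    unfold trigPoly
    refine continuous_finsetSum _ fun t _ ↦ ?_
    fun_prop
  have hI1 : Integrable (fun ξ ↦ ‖F ξ‖ * ‖trigPoly W (τ - ξ / T)‖) :=
    hFi.norm.mul_bdd (c := W.card) (hWcont.norm.aestronglyMeasurable)
      (Eventually.of_forall fun ξ ↦ by rw [Real.norm_eq_abs, abs_norm]; exact hWle _)
  have hI3 : Integrable (fun ξ ↦ ‖F ξ‖ * ‖trigPoly W (τ - ξ / T)‖ ^ 3) :=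
    hFi.norm.mul_bdd (c := (W.card : ℝ) ^ 3) ((hWcont.norm.pow 3).aestronglyMeasurable)
      (Eventually.of_forall fun ξ ↦ by
        rw [Real.norm_eq_abs, abs_of_nonneg (pow_nonneg (norm_nonneg _) 3)]
        exact pow_le_pow_left₀ (norm_nonneg _) (hWle _) 3)
  set J : ℝ := ∫ ξ, ‖F ξ‖ * ‖trigPoly W (τ - ξ / T)‖ ^ 3 with hJ
  have hJ0 : 0 ≤ J := integral_nonneg fun ξ ↦ by positivity
  have h1 : a ≤ ∫ ξ, ‖F ξ‖ * ‖trigPoly W (τ - ξ / T)‖ :=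
    norm_trigPoly_le_integral hψ hψs hψ1 hT W hW τ
  -- `a³ ≤ a² ∫ k g ≤ ∫ k (2c³a³ + c⁻⁶g³)/3` with `c³ = 1/(2A)`
  set c3 : ℝ := 1 / (2 * A) with hc3
  have hc30 : 0 < c3 := by positivity
  have h2 : a ^ 2 * ∫ ξ, ‖F ξ‖ * ‖trigPoly W (τ - ξ / T)‖ ≤
      (2 * c3 * a ^ 3 / 3) * (∫ ξ, ‖F ξ‖) + (1 / (3 * c3 ^ 2)) * J := by
    rw [← integral_const_mul, ← integral_const_mul, ← integral_const_mul, ← integral_add]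
    · refine integral_mono (hI1.const_mul _) ((hFi.norm.const_mul _).add (hI3.const_mul _))
        fun ξ ↦ ?_
      simp only
      have hk : 0 ≤ ‖F ξ‖ := norm_nonneg _
      set gξ : ℝ := ‖trigPoly W (τ - ξ / T)‖ with hgξ
      have hg0 : 0 ≤ gξ := norm_nonneg _
      -- pointwise: `a² g ≤ 2c3 a³/3 + g³/(3 c3²)`, from `u²v ≤ (2u³+v³)/3` with `u = c a`, `v = g/c²`
      -- where `c = c3^{1/3}`; we avoid cube roots by scaling: apply the inequality to
      -- `u = a * c3`, `v = gξ / c3 ^ 2`? (then u²v = a² gξ · c3² / c3² … ) -- use u = a, v = gξ/c3: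
      have key : a ^ 2 * gξ ≤ 2 * c3 * a ^ 3 / 3 + gξ ^ 3 / (3 * c3 ^ 2) := by
        have h := sq_mul_le_cubes (u := a) (v := gξ / c3) ha0 (by positivity)
        rw [div_pow] at h
        have e1 : a ^ 2 * (gξ / c3) = (a ^ 2 * gξ) / c3 := by ring
        rw [e1, div_le_iff₀ hc30] at h
        have e2 : (2 * a ^ 3 + gξ ^ 3 / c3 ^ 3) / 3 * c3 = 2 * c3 * a ^ 3 / 3 + gξ ^ 3 / (3 * c3 ^ 2) := by
          field_simp
        linarith [e2]
      calc a ^ 2 * (‖F ξ‖ * gξ) = ‖F ξ‖ * (a ^ 2 * gξ) := by ring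
        _ ≤ ‖F ξ‖ * (2 * c3 * a ^ 3 / 3 + gξ ^ 3 / (3 * c3 ^ 2)) := mul_le_mul_of_nonneg_left key hk
        _ = 2 * c3 * a ^ 3 / 3 * ‖F ξ‖ + 1 / (3 * c3 ^ 2) * (‖F ξ‖ * gξ ^ 3) := by ring
    · exact hFi.norm.const_mul _
    · exact hI3.const_mul _
  have h3 : a ^ 3 ≤ a ^ 3 / 3 + (4 * A ^ 2 / 3) * J := by
    calc a ^ 3 = a ^ 2 * a := by ring
      _ ≤ a ^ 2 * ∫ ξ, ‖F ξ‖ * ‖trigPoly W (τ - ξ / T)‖ :=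
          mul_le_mul_of_nonneg_left h1 (sq_nonneg _)
      _ ≤ (2 * c3 * a ^ 3 / 3) * (∫ ξ, ‖F ξ‖) + (1 / (3 * c3 ^ 2)) * J := h2
      _ ≤ (2 * c3 * a ^ 3 / 3) * A + (1 / (3 * c3 ^ 2)) * J := by gcongr
      _ = a ^ 3 / 3 + (4 * A ^ 2 / 3) * J := by rw [hc3]; field_simp; ring
  change a ^ 3 ≤ 2 * A ^ 2 * J
  nlinarith [h3]

end bump

/-- A bump with `ψ = 1` on `[0,1]` exists (Mathlib's `ContDiffBump` centred at `1/2`).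
[cite: GuthMaynard2026, Lemma 11.7 (proof)] -/
theorem exists_unitBump : ∃ ψ : ℝ → ℝ, ContDiff ℝ ∞ ψ ∧ HasCompactSupport ψ ∧
    ∀ x : ℝ, 0 ≤ x → x ≤ 1 → ψ x = 1 := by
  let f : ContDiffBump (1 / 2 : ℝ) := ⟨1 / 2, 1, by norm_num, by norm_num⟩
  refine ⟨f, f.contDiff, f.hasCompactSupport, fun x h0 h1 ↦ ?_⟩
  apply f.one_of_mem_closedBall
  rw [Metric.mem_closedBall, Real.dist_eq]
  show |x - 1 / 2| ≤ 1 / 2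
  rw [abs_le]; constructor <;> linarith

end GuthMaynardLocallyConstant

end Literature.NumberTheory.LFunctions

end
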